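import Summits.CriticalPhenomena.Ising3D.Control2DRhoCoordinate
import Summits.CriticalPhenomena.Ising3D.Control2DAbelianTail
import Mathlib.Analysis.SpecialFunctions.Pow.Real
import Mathlib.Analysis.SpecialFunctions.Log.Basic
import Mathlib.Tactic.Linarith
import Mathlib.Tactic.Positivity
import Mathlib.Tactic.FieldSimp
import Mathlib.Tactic.Ring
import Mathlib.Tactic.NormNum
import HarnessLib

/-!
# Squared OPE coefficients decay like `4^{-Δ}`: the `ρ`-coordinate leading-term bound applied to every unitary solution of
# the typed 2D sum rule at `Δ_σ > 0` (after Pappadopulo–Rychkov–Espin–Rattazzi 2012, §5.2)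
(cell `pub-ising3x`, seat controls-1 gen 47; PAPER §6.2 / Appendix E — CONTROL-ONLY; sequel to `Control2DRhoCoordinate`,
`Control2DConvergenceRate` (E.1n) and `Control2DAbelianTail` (E.1w))

HONEST FRAMING: lottery ticket; floor = tightest certified 3D Ising CFT bounds; no exact-solution
claim without a proof. CONTROL-ONLY (`d = 2`, global `sl(2) × sl(2)` blocks, `Δ_σ = s` an INPUT, axiom set `A2D′`);
nothing here is about `d = 3`, no certificate, functional or number of the record is touched, and no new hypothesis,
definition or named fact enters.

WHAT THIS FILE ADDS. E.1n (`Control2DConvergenceRate`) bounds the OPE data of every unitary typed solution at `Δ_σ = s > 0`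
POLYNOMIALLY: `Σ'_{Δ_i ≤ E} p_i ≤ ½e^{2s}(E/(2s))^{2s}G(½,½)`, `p_i ≤ ½e^{2s}(Δ_i/(2s))^{2s}G(½,½)`. With the Cauchy–Schwarz lower bound
`g_{Δ,ℓ}(z,z) ≥ 2(4ρ)^Δ` at `z = 4ρ/(1+ρ)²` of `Control2DRhoCoordinate` (the positivity input of PRER's `ρ`-frame argument, for the
typed class — the `ρ`-coordinate leading-term bound, not the `ρ`-expansion) the same two-point reasoning gives EXPONENTIAL
statements of the kind Pappadopulo–Rychkov–Espin–Rattazzi 2012 §5.2 derive in the `ρ`-frame, every constant explicit and `G(½,½)` the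
only datum-dependent quantity:
* `two_mul_tsum_p_mul_rpow_le` — `2 Σ_i p_i (4ρ)^{Δ_i} ≤ G(z,z) - 1` for every `ρ ∈ (0,1)` (hypothesis-free two-point form with NO
  cut-off: the OPE in the normalisation `4^Δ` has a convergent Laplace transform `Σ_i (p_i4^{Δ_i}) ρ^{Δ_i}` up to `ρ = 1`);
* **`sum_p_four_rpow_le`** — `Σ'_{Δ_i ≤ E} p_i 4^{Δ_i} ≤ ½ e^{4s} 16^s ((E+2s)/(4s))^{4s} G(½,½)` for `E ≥ 3s` — the elementary
  upper-bound half of «`F(E) ∼ E^{4Δ_φ}/Γ(4Δ_φ+1)`» (PRER §5.2) for the quasi-primaries of the typed class (E.1n's growth bound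
  `G(y,y) ≤ (y/(1-y))^{2s}G(½,½)` at the point `ρ = (E-2s)/(E+2s)`, `ρ^{-(E-2s)} = (1 + 4s/(E-2s))^{E-2s} ≤ e^{4s}`);
* **`p_le_exp_decay`** — `p_i ≤ ½ e^{4s} G(½,½) ((Δ_i+2s)/(4s))^{4s} · 4^{2s-Δ_i}` for `Δ_i ≥ 3s`: EVERY SQUARED OPE COEFFICIENT OF
  A UNITARY TYPED SOLUTION DECAYS LIKE `4^{-Δ}` (consistent with E.1u's `F(E) ∼ E^{2s}` count of STATES: the `sl(2) × sl(2)` tower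
  of a heavy quasi-primary outweighs it by up to `(1+ρ)^{2Δ} → 4^Δ`);
* **`tail_le_radial`** — the convergence RATE this buys at a diagonal point `x₀ < 4/5`: with `r = x₀/(4(1-x₀))`, `L = log(1/r)`,
  `Σ'_{Δ_i ≥ E} p_i g_i(x₀,x₀) ≤ e^{4s} 16^s (5/(12s))^{4s} E^{4s} G(½,½) · r^E · EL/(EL - 4s)` for `E ≥ 3s`, `EL > 4s` (the uniform
  envelope `g ≤ 2(x₀/(1-x₀))^Δ = 2·4^Δ r^Δ` and E.1w's Abelian lemma `tsum_ge_mul_exp_le_of_le_rpow` on the family `w_i = p_i4^{Δ_i}`):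
  base `r = ¼` at the crossing point `x₀ = ½` against E.1n/E.1w's `½` (the `r^{Δ_*}` estimate of PRER §5.1 with `r = |z|`); the sharp
  `ρ(½) = 3 - 2√2 ≈ 0.1716` of PRER §5.2 is NOT reached; `r/x₀ → ¼ = lim ρ(x₀)/x₀` as `x₀ → 0`;
* record rows at `Δ_σ = 1/8` (`G(½,½) ≤ 7/3`, gen-44 `record_fourPoint_half_le`): `record_sum_p_four_rpow_le`:
  `Σ'_{Δ_i ≤ E} p_i 4^{Δ_i} ≤ (7/6) e^{1/2} (4E+1)^{1/2}` (`E ≥ 3/8`); **`record_p_le_exp_decay`**: `p_i ≤ (7/6) e^{1/2} (4Δ_i+1)^{1/2} · 4^{-Δ_i}`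
  for every label with `Δ_i ≥ 3/8` (E.1n: `(7/6)e^{1/4}(4E)^{1/4}` resp. `(7/6)e^{1/4}(4Δ_i)^{1/4}`, polynomial).

NOT claimed: the `ρ`-EXPANSION itself / positivity of all `ρ`-coefficients of `k_{2h}` (Hogervorst–Rychkov 2013's
`(4ρ)^h ₂F₁(½,h;h+½;ρ²)` — the quadratic transformation; only its leading-term inequality is used), hence NOT the sharp rate
`|ρ(z)|^{Δ_*}` of Pappadopulo–Rychkov–Espin–Rattazzi (it needs the UPPER half `k_{2h} ≤ (4ρ)^h(1-ρ²)^{-1/2}`): the base reached here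
is `¼` at `x₀ = ½`, not `0.1716`, asymptotically sharp only as `x₀ → 0`; NOT the Tauberian EQUALITY `F_ρ(E) ∼ 16^s E^{4s}/Γ(4s+1)` (it
needs positivity of the full `ρ`-states series; upper bounds only, as E.1n stood before E.1u); no lower bound on any `p_i`; anything
off the real diagonal beyond monotone domination; complex `z` / the cut plane; `s = 0`; Virasoro; anything three-dimensional; any
bound on `Δ_ε`, `c` or `λ²`; no certificate, functional or number of the record touched, no new hypothesis or named fact. The two
papers are CONTEXT for what is proved, not cited inputs.

References: D. Pappadopulo, S. Rychkov, J. Espin, R. Rattazzi, Phys. Rev. D 86 (2012) 105043, §5.1–§5.2 (arXiv:1208.6449)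
[cite: PappadopuloRychkovEspinRattazzi2012PRD, §5.2]; R. Rattazzi, V. S. Rychkov, E. Tonni, A. Vichi, JHEP 12 (2008) 031, §3
[cite: RattazziEtAl2008, §3]. Tree: `rpow_four_mul_le_chiralBlock`, `two_mul_rpow_four_mul_le_globalBlock_diag`,
`globalBlock_diag_le_two_mul_rpow_div`, `four_mul_div_sq_mem_Ioo`, `four_mul_div_sq_div_one_sub`, `four_rpow_mul_exp_neg`, `sixteen_rpow_eq`,
`sixteen_rpow_eighth_mul`, `rpow_half_mul_four_rpow_quarter_sub` (`Control2DRhoCoordinate`);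
`fourPoint_diag_le`, `summable_p_le_dim`, `record_fourPoint_half_le` (`Control2DConvergenceRate`); `tsum_ge_mul_exp_le_of_le_rpow`
(`Control2DAbelianTail`); `opeConvergent_free` (`Control2DOpeConvergenceFree`); `fourPoint`, `one_le_fourPoint`, `globalBlock_nonneg`
(`Control2DFourPoint`). Mathlib: `Summable.of_nonneg_of_le`, `Summable.tsum_le_tsum`, `Summable.tsum_subtype_le`, `Real.add_one_le_exp`,
`Real.exp_log`, `Real.log_pos`, `Real.rpow_*`.
-/

namespace Summit.CriticalPhenomena.Ising3D.Control2D

open Set Filter Topology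
open Literature.MathematicalPhysics.QuantumFieldTheory.ConformalBootstrap3D

/-! ### The optimisation point `ρ = (E-2s)/(E+2s)` -/

/-- **The optimisation point** `ρ = (E-2s)/(E+2s)` of the `ρ`-frame estimate (`E ≥ 3s > 0`): it lies in `[1/5, 1)`, so
`z(ρ) = 4ρ/(1+ρ)² ≥ ½`; `1 - ρ = 4s/(E+2s)`; and `ρ^{-(E-2s)} = (1 + 4s/(E-2s))^{E-2s} ≤ e^{4s}`. [folklore] -/
theorem rhoPoint_spec {s E : ℝ} (hs : 0 < s) (hE : 3 * s ≤ E) :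
    (E - 2 * s) / (E + 2 * s) ∈ Ioo (0 : ℝ) 1 ∧ 1 / 5 ≤ (E - 2 * s) / (E + 2 * s) ∧
      1 / 2 ≤ 4 * ((E - 2 * s) / (E + 2 * s)) / (1 + (E - 2 * s) / (E + 2 * s)) ^ 2 ∧
      1 - (E - 2 * s) / (E + 2 * s) = 4 * s / (E + 2 * s) ∧
      (((E - 2 * s) / (E + 2 * s)) ^ (E - 2 * s))⁻¹ ≤ Real.exp (4 * s) := by
  have ha : 0 < E - 2 * s := by linarith
  have hb : 0 < E + 2 * s := by linarith
  have hρ0 : 0 < (E - 2 * s) / (E + 2 * s) := div_pos ha hb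
  have hρ1 : (E - 2 * s) / (E + 2 * s) < 1 := by rw [div_lt_one hb]; linarith
  have hρ5 : 1 / 5 ≤ (E - 2 * s) / (E + 2 * s) := by rw [le_div_iff₀ hb]; linarith
  refine ⟨⟨hρ0, hρ1⟩, hρ5, ?_, ?_, ?_⟩
  · set ρ := (E - 2 * s) / (E + 2 * s) with hρ
    have h1 : 0 < (1 + ρ) ^ 2 := by positivity
    rw [le_div_iff₀ h1]
    nlinarith [mul_nonneg (by linarith : (0 : ℝ) ≤ ρ - 1 / 5) (by linarith : (0 : ℝ) ≤ 1 - ρ)]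
  · field_simp; ring
  · rw [← Real.inv_rpow hρ0.le, inv_div]
    have h1 : (E + 2 * s) / (E - 2 * s) = 4 * s / (E - 2 * s) + 1 := by field_simp; ring
    have h2 : (E + 2 * s) / (E - 2 * s) ≤ Real.exp (4 * s / (E - 2 * s)) := by rw [h1]; exact Real.add_one_le_exp _
    have h3 := Real.rpow_le_rpow (div_pos hb ha).le h2 ha.le
    rwa [← Real.exp_mul, div_mul_cancel₀ _ ha.ne'] at h3

/-- The constant of the density bound at the optimisation point: with `ρ = (E-2s)/(E+2s)`,
`ρ^{-E} · (4ρ/(1-ρ)²)^{2s} = ρ^{-(E-2s)} · 16^s · ((E+2s)/(4s))^{4s} ≤ e^{4s} · 16^s · ((E+2s)/(4s))^{4s}`. [folklore] -/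
theorem rhoPoint_factor_le {s E : ℝ} (hs : 0 < s) (hE : 3 * s ≤ E) :
    (((E - 2 * s) / (E + 2 * s)) ^ E)⁻¹ *
        (4 * ((E - 2 * s) / (E + 2 * s)) / (1 - (E - 2 * s) / (E + 2 * s)) ^ 2) ^ (2 * s) ≤
      Real.exp (4 * s) * (16 : ℝ) ^ s * ((E + 2 * s) / (4 * s)) ^ (4 * s) := by
  obtain ⟨hρ, -, -, h1ρ, hexp⟩ := rhoPoint_spec hs hE
  set ρ : ℝ := (E - 2 * s) / (E + 2 * s) with hρdef
  have hb : 0 < E + 2 * s := by linarith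
  have hq : 0 < 1 - ρ := by linarith [hρ.2]
  have hρE : 0 < ρ ^ E := Real.rpow_pos_of_pos hρ.1 E
  have hρ2s : 0 < ρ ^ (2 * s) := Real.rpow_pos_of_pos hρ.1 _
  have hq4s : 0 < (1 - ρ) ^ (4 * s) := Real.rpow_pos_of_pos hq _
  -- `(4ρ/(1-ρ)²)^{2s} = 16^s ρ^{2s} / (1-ρ)^{4s}`
  have hA : (4 * ρ / (1 - ρ) ^ 2) ^ (2 * s) = (16 : ℝ) ^ s * ρ ^ (2 * s) / (1 - ρ) ^ (4 * s) := by
    rw [Real.div_rpow (by linarith [hρ.1]) (pow_nonneg hq.le 2), Real.mul_rpow (by norm_num) hρ.1.le, sixteen_rpow_eq,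
      ← Real.rpow_natCast (1 - ρ) 2, ← Real.rpow_mul hq.le]
    norm_num; ring_nf
  -- `ρ^{-E} ρ^{2s} = (ρ^{E-2s})⁻¹`
  have hB : (ρ ^ E)⁻¹ * ρ ^ (2 * s) = (ρ ^ (E - 2 * s))⁻¹ := by
    rw [Real.rpow_sub hρ.1]; field_simp
  -- `(1-ρ)^{-4s} = ((E+2s)/(4s))^{4s}`
  have hC : ((1 - ρ) ^ (4 * s))⁻¹ = ((E + 2 * s) / (4 * s)) ^ (4 * s) := by
    rw [h1ρ, ← Real.inv_rpow (div_pos (by linarith) hb).le, inv_div]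
  have hD : 0 ≤ (16 : ℝ) ^ s * ((E + 2 * s) / (4 * s)) ^ (4 * s) := by positivity
  calc (ρ ^ E)⁻¹ * (4 * ρ / (1 - ρ) ^ 2) ^ (2 * s)
      = (ρ ^ E)⁻¹ * ρ ^ (2 * s) * (16 : ℝ) ^ s * ((1 - ρ) ^ (4 * s))⁻¹ := by rw [hA]; field_simp
    _ = (ρ ^ (E - 2 * s))⁻¹ * ((16 : ℝ) ^ s * ((E + 2 * s) / (4 * s)) ^ (4 * s)) := by rw [hB, hC]; ring
    _ ≤ Real.exp (4 * s) * ((16 : ℝ) ^ s * ((E + 2 * s) / (4 * s)) ^ (4 * s)) :=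
        mul_le_mul_of_nonneg_right hexp hD
    _ = _ := by ring

namespace CrossingData

variable {D : CrossingData} {s : ℝ}

/-! ### The OPE in the `ρ`-frame: `2 Σ_i p_i (4ρ)^{Δ_i} ≤ G(z,z) - 1` -/

/-- For unitary data with convergent expansion and `ρ ∈ (0,1)`, the family `p_i (4ρ)^{Δ_i}` is summable (each term is at most half
of `p_i g_i(z,z)` at `z = 4ρ/(1+ρ)²`). [cite: PappadopuloRychkovEspinRattazzi2012PRD, §5.2] -/
theorem summable_p_mul_rpow_four_mul (hU : D.IsUnitary) (hconv : D.OpeConvergent) {ρ : ℝ} (hρ : ρ ∈ Ioo (0 : ℝ) 1) :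
    Summable fun i => D.p i * (4 * ρ) ^ D.Δ i := by
  have hz := four_mul_div_sq_mem_Ioo hρ
  have S := (hconv _ _ hz hz).mul_left (1 / 2)
  refine S.of_nonneg_of_le (fun i => mul_nonneg (hU i).2.2 (Real.rpow_nonneg (by linarith [hρ.1]) _)) fun i => ?_
  have hg := two_mul_rpow_four_mul_le_globalBlock_diag (hU i).2.1 hρ
  have hp0 : 0 ≤ D.p i := (hU i).2.2
  nlinarith [mul_le_mul_of_nonneg_left hg hp0]

/-- **Two-point form in the `ρ`-frame, no cut-off**: for unitary data with convergent expansion and every `ρ ∈ (0,1)`,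
`2 · Σ_i p_i (4ρ)^{Δ_i} ≤ G(z,z) - 1` at `z = 4ρ/(1+ρ)²` (termwise `2(4ρ)^{Δ_i} ≤ g_i(z,z)`). [cite: PappadopuloRychkovEspinRattazzi2012PRD, §5.2] -/
theorem two_mul_tsum_p_mul_rpow_le (hU : D.IsUnitary) (hconv : D.OpeConvergent) {ρ : ℝ} (hρ : ρ ∈ Ioo (0 : ℝ) 1) :
    2 * ∑' i, D.p i * (4 * ρ) ^ D.Δ i ≤
      D.fourPoint (4 * ρ / (1 + ρ) ^ 2) (4 * ρ / (1 + ρ) ^ 2) - 1 := by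
  have hz := four_mul_div_sq_mem_Ioo hρ
  set z : ℝ := 4 * ρ / (1 + ρ) ^ 2 with hzdef
  have hS := hconv z z hz hz
  have hP := summable_p_mul_rpow_four_mul hU hconv hρ
  have hle : ∀ i, 2 * (D.p i * (4 * ρ) ^ D.Δ i) ≤ D.p i * globalBlock (D.Δ i) (D.spin i) z z := by
    intro i
    have hg := two_mul_rpow_four_mul_le_globalBlock_diag (hU i).2.1 hρ
    have hp0 : 0 ≤ D.p i := (hU i).2.2
    nlinarith [mul_le_mul_of_nonneg_left hg hp0]
  have h1 : 2 * ∑' i, D.p i * (4 * ρ) ^ D.Δ i ≤ ∑' i, D.p i * globalBlock (D.Δ i) (D.spin i) z z := by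
    rw [← tsum_mul_left]
    exact (hP.mul_left 2).tsum_le_tsum hle hS
  have h2 : D.fourPoint z z - 1 = ∑' i, D.p i * globalBlock (D.Δ i) (D.spin i) z z := by unfold fourPoint; ring
  linarith

/-- **The Laplace form**: for every `t > 0` the family `(p_i 4^{Δ_i}) e^{-tΔ_i} = p_i (4e^{-t})^{Δ_i}` is summable — the
hypothesis of E.1w's Abelian lemma for the weights `w_i = p_i 4^{Δ_i}`. [cite: PappadopuloRychkovEspinRattazzi2012PRD, §5.2] -/
theorem summable_p_four_rpow_mul_exp (hU : D.IsUnitary) (hconv : D.OpeConvergent) {t : ℝ} (ht : 0 < t) :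
    Summable fun i => D.p i * (4 : ℝ) ^ D.Δ i * Real.exp (-(t * D.Δ i)) := by
  have hρ : Real.exp (-t) ∈ Ioo (0 : ℝ) 1 :=
    ⟨Real.exp_pos _, by rw [← Real.exp_zero]; exact Real.exp_lt_exp.mpr (by linarith)⟩
  refine (summable_p_mul_rpow_four_mul hU hconv hρ).congr fun i => ?_
  rw [mul_assoc, four_rpow_mul_exp_neg]

/-- **The `ρ`-frame density, two-point form with the growth bound**: for every unitary solution of the typed sum rule at
`s > 0` and every `ρ ∈ (0,1)` with `z(ρ) = 4ρ/(1+ρ)² ≥ ½` (e.g. `ρ ≥ 1/5`), `Σ_i p_i (4ρ)^{Δ_i} ≤ ½ (4ρ/(1-ρ)²)^{2s} G(½,½)` (E.1n's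
`fourPoint_diag_le`, `z/(1-z) = 4ρ/(1-ρ)²`). [cite: PappadopuloRychkovEspinRattazzi2012PRD, §5.2] -/
theorem tsum_p_mul_rpow_le (hU : D.IsUnitary) (hC : D.SatisfiesCrossing s) (hs : 0 < s) {ρ : ℝ} (hρ : ρ ∈ Ioo (0 : ℝ) 1)
    (hz2 : 1 / 2 ≤ 4 * ρ / (1 + ρ) ^ 2) :
    ∑' i, D.p i * (4 * ρ) ^ D.Δ i ≤ 1 / 2 * (4 * ρ / (1 - ρ) ^ 2) ^ (2 * s) * D.fourPoint (1 / 2) (1 / 2) := by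
  have hconv := opeConvergent_free hU hC hs
  have hz := four_mul_div_sq_mem_Ioo hρ
  have h1 := two_mul_tsum_p_mul_rpow_le hU hconv hρ
  have h2 := fourPoint_diag_le hU hC hs hz2 hz.2
  rw [four_mul_div_sq_div_one_sub hρ.1.le hρ.2] at h2
  have hG1 := one_le_fourPoint hU (z := 1 / 2) (zb := 1 / 2) ⟨by norm_num, by norm_num⟩ ⟨by norm_num, by norm_num⟩
  have hA : 0 ≤ (4 * ρ / (1 - ρ) ^ 2) ^ (2 * s) := Real.rpow_nonneg (div_nonneg (by linarith [hρ.1]) (sq_nonneg _)) _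
  nlinarith

/-! ### The integrated density in the normalisation `4^Δ` and the exponential decay of the coefficients -/

/-- The weights `p_i 4^{Δ_i}` of the labels of dimension `≤ E` are summable (bounded by `4^E p_i`; E.1n's `summable_p_le_dim`).
[folklore] -/
theorem summable_p_four_rpow_le_dim (hU : D.IsUnitary) (hconv : D.OpeConvergent) (E : ℝ) :
    Summable fun i : ↥({i : D.ι | D.Δ i ≤ E} : Set D.ι) => D.p i * (4 : ℝ) ^ D.Δ (i : D.ι) := by
  have S := (summable_p_le_dim hU hconv E).mul_left ((4 : ℝ) ^ E)
  refine S.of_nonneg_of_le (fun i => mul_nonneg (hU i).2.2 (Real.rpow_nonneg (by norm_num) _)) fun i => ?_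
  have hi : D.Δ (i : D.ι) ≤ E := i.2
  have h4 : (4 : ℝ) ^ D.Δ (i : D.ι) ≤ (4 : ℝ) ^ E := Real.rpow_le_rpow_of_exponent_le (by norm_num) hi
  have hp0 : 0 ≤ D.p i := (hU i).2.2
  nlinarith

/-- **The integrated OPE density in the normalisation `4^Δ` grows at most like `E^{4s}`** (the elementary upper-bound half of
Pappadopulo–Rychkov–Espin–Rattazzi's `ρ`-frame density `F(E) ∼ E^{4Δ_φ}/Γ(4Δ_φ+1)`, for the quasi-primaries of the typed class):
for every unitary solution of the typed sum rule at `Δ_σ = s > 0` and every `E ≥ 3s`,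
`Σ'_{Δ_i ≤ E} p_i 4^{Δ_i} ≤ ½ · e^{4s} · 16^s · ((E+2s)/(4s))^{4s} · G(½,½)`. Proof: at `ρ = (E-2s)/(E+2s)`, `4^{Δ_i} ≤ ρ^{-E}(4ρ)^{Δ_i}`
for `Δ_i ≤ E`, the two-point form, and `rhoPoint_factor_le`. [cite: PappadopuloRychkovEspinRattazzi2012PRD, §5.2] -/
theorem sum_p_four_rpow_le (hU : D.IsUnitary) (hC : D.SatisfiesCrossing s) (hs : 0 < s) {E : ℝ} (hE : 3 * s ≤ E) :
    ∑' i : ↥({i : D.ι | D.Δ i ≤ E} : Set D.ι), D.p i * (4 : ℝ) ^ D.Δ (i : D.ι) ≤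
      1 / 2 * Real.exp (4 * s) * (16 : ℝ) ^ s * ((E + 2 * s) / (4 * s)) ^ (4 * s) * D.fourPoint (1 / 2) (1 / 2) := by
  have hconv := opeConvergent_free hU hC hs
  obtain ⟨hρ, -, hz2, -, -⟩ := rhoPoint_spec hs hE
  have hfac := rhoPoint_factor_le hs hE
  set ρ : ℝ := (E - 2 * s) / (E + 2 * s) with hρdef
  set T : Set D.ι := {i : D.ι | D.Δ i ≤ E} with hT
  have hρE : 0 < ρ ^ E := Real.rpow_pos_of_pos hρ.1 E
  have hP := summable_p_mul_rpow_four_mul hU hconv hρ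
  have hPT : Summable fun i : ↥T => D.p i * (4 * ρ) ^ D.Δ (i : D.ι) := hP.subtype T
  -- termwise: `p_i 4^{Δ_i} ≤ ρ^{-E} · p_i (4ρ)^{Δ_i}` on `T`
  have hle : ∀ i : ↥T, D.p i * (4 : ℝ) ^ D.Δ (i : D.ι) ≤ (ρ ^ E)⁻¹ * (D.p i * (4 * ρ) ^ D.Δ (i : D.ι)) := by
    intro i
    have hi : D.Δ (i : D.ι) ≤ E := i.2
    have hp0 : 0 ≤ D.p i := (hU i).2.2
    have h4 : 0 ≤ (4 : ℝ) ^ D.Δ (i : D.ι) := Real.rpow_nonneg (by norm_num) _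
    have hρΔ : ρ ^ E ≤ ρ ^ D.Δ (i : D.ι) := Real.rpow_le_rpow_of_exponent_ge hρ.1 hρ.2.le hi
    rw [Real.mul_rpow (by norm_num) hρ.1.le]
    calc D.p i * (4 : ℝ) ^ D.Δ (i : D.ι) = (ρ ^ E)⁻¹ * (D.p i * (4 : ℝ) ^ D.Δ (i : D.ι) * ρ ^ E) := by field_simp
      _ ≤ (ρ ^ E)⁻¹ * (D.p i * (4 : ℝ) ^ D.Δ (i : D.ι) * ρ ^ D.Δ (i : D.ι)) :=
          mul_le_mul_of_nonneg_left (mul_le_mul_of_nonneg_left hρΔ (mul_nonneg hp0 h4)) (inv_nonneg.mpr hρE.le)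
      _ = _ := by ring
  have h1 : ∑' i : ↥T, D.p i * (4 : ℝ) ^ D.Δ (i : D.ι) ≤ (ρ ^ E)⁻¹ * ∑' i : ↥T, D.p i * (4 * ρ) ^ D.Δ (i : D.ι) := by
    rw [← tsum_mul_left]
    exact (summable_p_four_rpow_le_dim hU hconv E).tsum_le_tsum hle (hPT.mul_left _)
  have h2 : ∑' i : ↥T, D.p i * (4 * ρ) ^ D.Δ (i : D.ι) ≤ ∑' i, D.p i * (4 * ρ) ^ D.Δ i :=
    hP.tsum_subtype_le _ T (fun i => mul_nonneg (hU i).2.2 (Real.rpow_nonneg (by linarith [hρ.1]) _))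
  have h3 := tsum_p_mul_rpow_le hU hC hs hρ hz2
  have hG0 : 0 ≤ D.fourPoint (1 / 2) (1 / 2) := by
    have := one_le_fourPoint hU (z := 1 / 2) (zb := 1 / 2) ⟨by norm_num, by norm_num⟩ ⟨by norm_num, by norm_num⟩
    linarith
  calc ∑' i : ↥T, D.p i * (4 : ℝ) ^ D.Δ (i : D.ι)
      ≤ (ρ ^ E)⁻¹ * ∑' i, D.p i * (4 * ρ) ^ D.Δ i := h1.trans (mul_le_mul_of_nonneg_left h2 (inv_nonneg.mpr hρE.le))
    _ ≤ (ρ ^ E)⁻¹ * (1 / 2 * (4 * ρ / (1 - ρ) ^ 2) ^ (2 * s) * D.fourPoint (1 / 2) (1 / 2)) :=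
        mul_le_mul_of_nonneg_left h3 (inv_nonneg.mpr hρE.le)
    _ = 1 / 2 * ((ρ ^ E)⁻¹ * (4 * ρ / (1 - ρ) ^ 2) ^ (2 * s)) * D.fourPoint (1 / 2) (1 / 2) := by ring
    _ ≤ 1 / 2 * (Real.exp (4 * s) * (16 : ℝ) ^ s * ((E + 2 * s) / (4 * s)) ^ (4 * s)) * D.fourPoint (1 / 2) (1 / 2) :=
        mul_le_mul_of_nonneg_right (mul_le_mul_of_nonneg_left hfac (by norm_num)) hG0
    _ = _ := by ring

/-- **Every squared OPE coefficient decays like `4^{-Δ}`**: for every unitary solution of the typed sum rule at `Δ_σ = s > 0` and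
every label with `Δ_i ≥ 3s`, `p_i ≤ ½ e^{4s} G(½,½) ((Δ_i+2s)/(4s))^{4s} · 4^{2s-Δ_i}` (a single term of the density at `E = Δ_i`;
`16^s 4^{-Δ} = 4^{2s-Δ}`). E.1n's polynomial `p_le_of_le_dim` made exponential. [cite: PappadopuloRychkovEspinRattazzi2012PRD, §5.2] -/
theorem p_le_exp_decay (hU : D.IsUnitary) (hC : D.SatisfiesCrossing s) (hs : 0 < s) (i : D.ι) (hi : 3 * s ≤ D.Δ i) :
    D.p i ≤ 1 / 2 * Real.exp (4 * s) * D.fourPoint (1 / 2) (1 / 2) * ((D.Δ i + 2 * s) / (4 * s)) ^ (4 * s) *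
      (4 : ℝ) ^ (2 * s - D.Δ i) := by
  have hconv := opeConvergent_free hU hC hs
  have hS := summable_p_four_rpow_le_dim hU hconv (D.Δ i)
  have h1 : D.p i * (4 : ℝ) ^ D.Δ i ≤ ∑' j : ↥({j : D.ι | D.Δ j ≤ D.Δ i} : Set D.ι), D.p j * (4 : ℝ) ^ D.Δ (j : D.ι) :=
    hS.le_tsum ⟨i, (le_rfl : D.Δ i ≤ D.Δ i)⟩ fun j _ => mul_nonneg (hU j).2.2 (Real.rpow_nonneg (by norm_num) _)
  have h2 := h1.trans (sum_p_four_rpow_le hU hC hs hi)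
  have h4 : 0 < (4 : ℝ) ^ D.Δ i := Real.rpow_pos_of_pos (by norm_num) _
  have hsplit : (4 : ℝ) ^ (2 * s - D.Δ i) = (16 : ℝ) ^ s * ((4 : ℝ) ^ D.Δ i)⁻¹ := by
    rw [Real.rpow_sub (by norm_num : (0 : ℝ) < 4), sixteen_rpow_eq, div_eq_mul_inv]
  rw [hsplit]
  calc D.p i = D.p i * (4 : ℝ) ^ D.Δ i * ((4 : ℝ) ^ D.Δ i)⁻¹ := by field_simp
    _ ≤ 1 / 2 * Real.exp (4 * s) * (16 : ℝ) ^ s * ((D.Δ i + 2 * s) / (4 * s)) ^ (4 * s) * D.fourPoint (1 / 2) (1 / 2) *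
          ((4 : ℝ) ^ D.Δ i)⁻¹ := mul_le_mul_of_nonneg_right h2 (inv_nonneg.mpr h4.le)
    _ = _ := by ring

/-! ### The convergence rate at a diagonal point `x₀ < 4/5` -/

/-- The density bound in the form the Abelian lemma wants: for `u ≥ E ≥ 3s`, `Σ'_{Δ_i ≤ u} p_i 4^{Δ_i} ≤ B · u^{4s}` with
`B = ½ e^{4s} 16^s (5/(12s))^{4s} G(½,½)` (`u + 2s ≤ 5u/3`). [folklore] -/
theorem sum_p_four_rpow_le_mul_rpow (hU : D.IsUnitary) (hC : D.SatisfiesCrossing s) (hs : 0 < s) {E u : ℝ} (hE : 3 * s ≤ E)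
    (hu : E ≤ u) :
    ∑' i : ↥({i : D.ι | D.Δ i ≤ u} : Set D.ι), D.p i * (4 : ℝ) ^ D.Δ (i : D.ι) ≤
      1 / 2 * Real.exp (4 * s) * (16 : ℝ) ^ s * (5 / (12 * s)) ^ (4 * s) * D.fourPoint (1 / 2) (1 / 2) * u ^ (4 * s) := by
  have h := sum_p_four_rpow_le hU hC hs (E := u) (by linarith)
  have hu0 : 0 ≤ u := by linarith
  have hmono : ((u + 2 * s) / (4 * s)) ^ (4 * s) ≤ (5 / (12 * s) * u) ^ (4 * s) := by
    refine Real.rpow_le_rpow (div_nonneg (by linarith) (by linarith)) ?_ (by linarith)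
    rw [div_le_iff₀ (by linarith)]
    have : 5 / (12 * s) * u * (4 * s) = 5 / 3 * u := by field_simp; ring
    rw [this]; linarith
  rw [Real.mul_rpow (by positivity) hu0] at hmono
  have hG0 : 0 ≤ D.fourPoint (1 / 2) (1 / 2) := by
    have := one_le_fourPoint hU (z := 1 / 2) (zb := 1 / 2) ⟨by norm_num, by norm_num⟩ ⟨by norm_num, by norm_num⟩
    linarith
  have hK : 0 ≤ 1 / 2 * Real.exp (4 * s) * (16 : ℝ) ^ s := by positivity
  calc ∑' i : ↥({i : D.ι | D.Δ i ≤ u} : Set D.ι), D.p i * (4 : ℝ) ^ D.Δ (i : D.ι)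
      ≤ 1 / 2 * Real.exp (4 * s) * (16 : ℝ) ^ s * ((u + 2 * s) / (4 * s)) ^ (4 * s) * D.fourPoint (1 / 2) (1 / 2) := h
    _ ≤ 1 / 2 * Real.exp (4 * s) * (16 : ℝ) ^ s * ((5 / (12 * s)) ^ (4 * s) * u ^ (4 * s)) * D.fourPoint (1 / 2) (1 / 2) :=
        mul_le_mul_of_nonneg_right (mul_le_mul_of_nonneg_left hmono hK) hG0
    _ = _ := by ring

/-- **The convergence rate bought by the Cauchy–Schwarz lower bound and the uniform envelope**: for every unitary solution of the typed sum rule at `Δ_σ = s > 0`, every diagonal point `0 < x₀ < 4/5` and every cut-off `E ≥ 3s` with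
`E · L > 4s`, where `r = x₀/(4(1-x₀)) < 1` and `L = log(4(1-x₀)/x₀) = log(1/r)`:
`Σ'_{Δ_i ≥ E} p_i g_i(x₀,x₀) ≤ e^{4s} 16^s (5/(12s))^{4s} E^{4s} G(½,½) · r^E · EL/(EL - 4s)` — termwise
`p_i g_i(x₀,x₀) ≤ 2 p_i (x₀/(1-x₀))^{Δ_i} = 2 (p_i4^{Δ_i}) e^{-LΔ_i}`, then E.1w's `tsum_ge_mul_exp_le_of_le_rpow` with the density bound
`sum_p_four_rpow_le_mul_rpow`. At `x₀ = ½`: base `r = ¼` (E.1n: `½`; the sharp `ρ(½) = 3 - 2√2 ≈ 0.1716` of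
Pappadopulo–Rychkov–Espin–Rattazzi is NOT reached). [cite: PappadopuloRychkovEspinRattazzi2012PRD, §5.2] -/
theorem tail_le_radial (hU : D.IsUnitary) (hC : D.SatisfiesCrossing s) (hs : 0 < s) {x₀ E : ℝ} (hx₀ : 0 < x₀)
    (hx₁ : x₀ < 4 / 5) (hE : 3 * s ≤ E) (hEL : 4 * s < E * Real.log (4 * (1 - x₀) / x₀)) :
    ∑' i : ↥({i : D.ι | E ≤ D.Δ i} : Set D.ι), D.p i * globalBlock (D.Δ i) (D.spin i) x₀ x₀ ≤
      Real.exp (4 * s) * (16 : ℝ) ^ s * (5 / (12 * s)) ^ (4 * s) * E ^ (4 * s) * D.fourPoint (1 / 2) (1 / 2) *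
        (x₀ / (4 * (1 - x₀))) ^ E *
        (E * Real.log (4 * (1 - x₀) / x₀) / (E * Real.log (4 * (1 - x₀) / x₀) - 4 * s)) := by
  have hconv := opeConvergent_free hU hC hs
  have hx1 : x₀ < 1 := by linarith
  have hE0 : 0 < E := by linarith
  set t : ℝ := Real.log (4 * (1 - x₀) / x₀) with htdef
  set T : Set D.ι := {i : D.ι | E ≤ D.Δ i} with hT
  have hq : 1 < 4 * (1 - x₀) / x₀ := by rw [lt_div_iff₀ hx₀]; linarith
  have hq0 : 0 < 4 * (1 - x₀) / x₀ := by linarith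
  have ht : 0 < t := Real.log_pos hq
  have hexp : Real.exp (-t) = x₀ / (4 * (1 - x₀)) := by
    rw [htdef, Real.exp_neg, Real.exp_log hq0, inv_div]
  -- the weights `w_i = p_i 4^{Δ_i}` and E.1w's Abelian lemma
  have hw : ∀ i, 0 ≤ D.p i * (4 : ℝ) ^ D.Δ i := fun i => mul_nonneg (hU i).2.2 (Real.rpow_nonneg (by norm_num) _)
  have hAbel := tsum_ge_mul_exp_le_of_le_rpow (w := fun i => D.p i * (4 : ℝ) ^ D.Δ i) (E := D.Δ) hw
    (fun t ht => summable_p_four_rpow_mul_exp hU hconv ht) (B := 1 / 2 * Real.exp (4 * s) * (16 : ℝ) ^ s *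
      (5 / (12 * s)) ^ (4 * s) * D.fourPoint (1 / 2) (1 / 2)) (ρ := 4 * s) (T := E) (t := t) (by linarith) hE0 ht
    (by linarith) (fun u hu => sum_p_four_rpow_le_mul_rpow hU hC hs hE hu)
  -- termwise: `p_i g_i(x₀,x₀) ≤ 2 w_i e^{-tΔ_i}`
  have hWT : Summable fun i : ↥T => D.p i * (4 : ℝ) ^ D.Δ (i : D.ι) * Real.exp (-(t * D.Δ (i : D.ι))) :=
    (summable_p_four_rpow_mul_exp hU hconv ht).subtype T
  have hle : ∀ i : ↥T, D.p i * globalBlock (D.Δ (i : D.ι)) (D.spin (i : D.ι)) x₀ x₀ ≤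
      2 * (D.p i * (4 : ℝ) ^ D.Δ (i : D.ι) * Real.exp (-(t * D.Δ (i : D.ι)))) := by
    intro i
    have hg := globalBlock_diag_le_two_mul_rpow_div (hU i).2.1 hx₀ hx1
    have hp0 : 0 ≤ D.p i := (hU i).2.2
    have hr : x₀ / (1 - x₀) = 4 * Real.exp (-t) := by rw [hexp]; field_simp
    rw [hr, ← four_rpow_mul_exp_neg] at hg
    nlinarith [mul_le_mul_of_nonneg_left hg hp0]
  have h1 : ∑' i : ↥T, D.p i * globalBlock (D.Δ (i : D.ι)) (D.spin (i : D.ι)) x₀ x₀ ≤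
      2 * ∑' i : ↥T, D.p i * (4 : ℝ) ^ D.Δ (i : D.ι) * Real.exp (-(t * D.Δ (i : D.ι))) := by
    rw [← tsum_mul_left]
    exact ((hconv x₀ x₀ ⟨hx₀, hx1⟩ ⟨hx₀, hx1⟩).subtype T).tsum_le_tsum hle (hWT.mul_left 2)
  -- `e^{-tE} = r^E`
  have hrE : Real.exp (-(t * E)) = (x₀ / (4 * (1 - x₀))) ^ E := by
    rw [show -(t * E) = -t * E by ring, Real.exp_mul, hexp]
  have hmain := h1.trans (mul_le_mul_of_nonneg_left hAbel (by norm_num))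
  rw [hrE] at hmain
  refine hmain.trans (le_of_eq ?_)
  ring

end CrossingData

/-! ### The record's class at `Δ_σ = 1/8` -/

/-- **The `ρ`-frame density of every datum of the record's class at `Δ_σ = 1/8`** (binders of `record_sum_p_low_le`; `G(½,½) ≤ 7/3`):
for every `E ≥ 3/8`, `Σ'_{Δ_i ≤ E} p_i 4^{Δ_i} ≤ (7/6) · e^{1/2} · (4E+1)^{1/2}` (`16^{1/8}((E+1/4)/(1/2))^{1/2} = (4E+1)^{1/2}`) — against
E.1n's `(7/6)e^{1/4}(4E)^{1/4}` for `Σ'_{Δ_i ≤ E} p_i`. CONTROL-ONLY; no certificate or number of the record is touched. [folklore] -/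
theorem record_sum_p_four_rpow_le (w : ℝ) (D : CrossingData) (hU : D.IsUnitary) (hC : D.SatisfiesCrossing (1 / 8))
    (hT : D.SpinTwoIn ({2} ∪ Ici (2 + 1))) (x : ℝ) (hwx : w ≤ x) (hS : D.ScalarsIn ({x} ∪ Ici 2)) {E : ℝ}
    (hE : 3 / 8 ≤ E) :
    ∑' i : ↥({i : D.ι | D.Δ i ≤ E} : Set D.ι), D.p i * (4 : ℝ) ^ D.Δ (i : D.ι) ≤
      7 / 6 * Real.exp (1 / 2) * (4 * E + 1) ^ (1 / 2 : ℝ) := by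
  have h := CrossingData.sum_p_four_rpow_le hU hC (s := 1 / 8) (by norm_num) (E := E) (by linarith)
  have hG := record_fourPoint_half_le w D hU hC hT x hwx hS
  rw [show (4 * (1 / 8 : ℝ)) = 1 / 2 by norm_num, show (2 * (1 / 8 : ℝ)) = 1 / 4 by norm_num,
    show (E + 1 / 4) / (1 / 2) = 2 * E + 1 / 2 by ring, mul_assoc (1 / 2 * Real.exp (1 / 2)),
    sixteen_rpow_eighth_mul (by linarith : (0 : ℝ) ≤ 2 * E + 1 / 2),
    show 2 * (2 * E + 1 / 2) = 4 * E + 1 by ring] at h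
  have hA : 0 ≤ 1 / 2 * Real.exp (1 / 2) * (4 * E + 1) ^ (1 / 2 : ℝ) := by positivity
  calc ∑' i : ↥({i : D.ι | D.Δ i ≤ E} : Set D.ι), D.p i * (4 : ℝ) ^ D.Δ (i : D.ι)
      ≤ 1 / 2 * Real.exp (1 / 2) * (4 * E + 1) ^ (1 / 2 : ℝ) * D.fourPoint (1 / 2) (1 / 2) := h
    _ ≤ 1 / 2 * Real.exp (1 / 2) * (4 * E + 1) ^ (1 / 2 : ℝ) * (7 / 3) := mul_le_mul_of_nonneg_left hG hA
    _ = _ := by ring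

/-- **Exponential decay of the squared OPE coefficients of every datum of the record's class at `Δ_σ = 1/8`**: every label with
`Δ_i ≥ 3/8` has `p_i ≤ (7/6) · e^{1/2} · (4Δ_i+1)^{1/2} · 4^{-Δ_i}` (`((Δ_i+1/4)/(1/2))^{1/2} 4^{1/4-Δ_i} = (4Δ_i+1)^{1/2} 4^{-Δ_i}`) —
against E.1n's polynomial `(7/6)e^{1/4}(4Δ_i)^{1/4}`. CONTROL-ONLY; no certificate or number of the record is touched. [folklore] -/
theorem record_p_le_exp_decay (w : ℝ) (D : CrossingData) (hU : D.IsUnitary) (hC : D.SatisfiesCrossing (1 / 8))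
    (hT : D.SpinTwoIn ({2} ∪ Ici (2 + 1))) (x : ℝ) (hwx : w ≤ x) (hS : D.ScalarsIn ({x} ∪ Ici 2)) (i : D.ι)
    (hi : 3 / 8 ≤ D.Δ i) :
    D.p i ≤ 7 / 6 * Real.exp (1 / 2) * (4 * D.Δ i + 1) ^ (1 / 2 : ℝ) * (4 : ℝ) ^ (-D.Δ i) := by
  have h := CrossingData.p_le_exp_decay hU hC (s := 1 / 8) (by norm_num) i (by linarith)
  have hG := record_fourPoint_half_le w D hU hC hT x hwx hS
  have hΔ : (0 : ℝ) ≤ 2 * D.Δ i + 1 / 2 := by linarith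
  rw [show (4 * (1 / 8 : ℝ)) = 1 / 2 by norm_num, show (2 * (1 / 8 : ℝ)) = 1 / 4 by norm_num,
    show (D.Δ i + 1 / 4) / (1 / 2) = 2 * D.Δ i + 1 / 2 by ring, mul_assoc (1 / 2 * Real.exp (1 / 2) * D.fourPoint (1 / 2) (1 / 2)),
    rpow_half_mul_four_rpow_quarter_sub hΔ, show 2 * (2 * D.Δ i + 1 / 2) = 4 * D.Δ i + 1 by ring] at h
  have hA : 0 ≤ (4 * D.Δ i + 1) ^ (1 / 2 : ℝ) * (4 : ℝ) ^ (-D.Δ i) := by positivity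
  have hB : 0 ≤ 1 / 2 * Real.exp (1 / 2) := by positivity
  calc D.p i ≤ 1 / 2 * Real.exp (1 / 2) * D.fourPoint (1 / 2) (1 / 2) * ((4 * D.Δ i + 1) ^ (1 / 2 : ℝ) * (4 : ℝ) ^ (-D.Δ i)) := h
    _ ≤ 1 / 2 * Real.exp (1 / 2) * (7 / 3) * ((4 * D.Δ i + 1) ^ (1 / 2 : ℝ) * (4 : ℝ) ^ (-D.Δ i)) :=
        mul_le_mul_of_nonneg_right (mul_le_mul_of_nonneg_left hG hB) hA
    _ = _ := by ring

end Summit.CriticalPhenomena.Ising3D.Control2D
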